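import Mathlib.Analysis.Complex.JensenFormula
import Literature.Analysis.Complex.BacklundJensenAverage
import HarnessLib

/-!
# Lemmas for the density theorem on zeros of the Weil transform of a short window

Bookkeeping for `WeilLineZerosDensity.lean` (zeros `1/2 + iμ_n` of uniform density `d` of the
transform `Ŵ` of a window `W` supported in `[-b, b]`, `b < π d`, force `Ŵ ≡ 0` on the critical
line), kept separate to respect the file-size convention:

* level-set counting: `log(R/v) ≥ h · #{j < J : v ≤ R e^{-(j+1)h}}`
  (`mul_card_filter_le_log_div`), the exchange of the two counts (`sum_card_filter_comm`), the
  count `#{n : |μ_n| ≤ ρ} ≥ 2d(ρ - M) - 1` for `|μ_n - n/d| ≤ M` (`two_mul_sub_le_card_filter`),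
  the choice of `h, J` with `h Σ_{j<J} e^{-(j+1)h} ≥ q + h` for `q < 1`
  (`exists_levelSet_parameters`) and the resulting linear lower bound
  `Σ_{|μ_n| ≤ R} log(R/|μ_n|) ≥ 2dσR - C` (`levelSet_count_le_sum_log`);
* the circle average of the majorant `log K + b|Re z - 1/2|` over `|z - 1/2| = R` is at most
  `log K + 2bR/π` (`circleAverage_log_add_mul_abs_re_le`, via
  `Literature.Analysis.Complex.circleAverage_re_eq` / `integral_le_sum_affine_cos`);
* Jensen's sum over the disc `|s - 1/2| ≤ R` dominates `Σ_{|μ_n| ≤ R} log(R/|μ_n|)` when the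
  entire function vanishes at the `1/2 + iμ_n` and not at `1/2` (`sum_log_div_le_jensen_sum`,
  from Mathlib's divisor API).

Everything is proved (folklore real/complex analysis); no definitions, no named facts.
-/

noncomputable section

open Complex Set MeasureTheory Filter Metric
open scoped Real Topology

namespace Literature.NumberTheory.LFunctions
/-! ### Elementary counting -/

/-- Level-set minorant of the logarithm: for `0 < v ≤ R`, `0 < h`, `0 < x = e^{-h}`,
`h · #{j < J : v ≤ R x^{j+1}} ≤ log (R / v)`. [folklore] -/
theorem mul_card_filter_le_log_div {v R h : ℝ} (hv : 0 < v) (hvR : v ≤ R) (hh : 0 < h) (J : ℕ) :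
    h * (((Finset.range J).filter fun j => v ≤ R * Real.exp (-h) ^ (j + 1)).card : ℝ) ≤
      Real.log (R / v) := by
  have hR : 0 < R := hv.trans_le hvR
  set L : ℝ := Real.log (R / v) with hL
  have hL0 : 0 ≤ L := Real.log_nonneg (by rw [le_div_iff₀ hv, one_mul]; exact hvR)
  have hsub : ((Finset.range J).filter fun j => v ≤ R * Real.exp (-h) ^ (j + 1)) ⊆
      Finset.range ⌊L / h⌋₊ := by
    intro j hj
    rw [Finset.mem_filter] at hj
    rw [Finset.mem_range]
    have hj2 := hj.2
    have hexp : Real.exp (-h) ^ (j + 1) = Real.exp (-((j + 1 : ℕ) * h)) := by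
      rw [← Real.exp_nat_mul]; congr 1; ring
    rw [hexp] at hj2
    -- `v ≤ R e^{-(j+1)h}` gives `(j+1) h ≤ log (R/v)`
    have h1 : ((j + 1 : ℕ) : ℝ) * h ≤ L := by
      have h2 : v * Real.exp (((j + 1 : ℕ) : ℝ) * h) ≤ R := by
        have := mul_le_mul_of_nonneg_right hj2 (Real.exp_pos (((j + 1 : ℕ) : ℝ) * h)).le
        rwa [mul_assoc, ← Real.exp_add, neg_add_cancel, Real.exp_zero, mul_one] at this
      rw [hL, Real.le_log_iff_exp_le (div_pos hR hv), le_div_iff₀ hv, mul_comm]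
      exact h2
    have h3 : ((j + 1 : ℕ) : ℝ) ≤ L / h := by rw [le_div_iff₀ hh]; exact h1
    have h4 : j + 1 ≤ ⌊L / h⌋₊ := Nat.le_floor h3
    omega
  have hcard := Finset.card_le_card hsub
  rw [Finset.card_range] at hcard
  calc h * (((Finset.range J).filter fun j => v ≤ R * Real.exp (-h) ^ (j + 1)).card : ℝ)
      ≤ h * (⌊L / h⌋₊ : ℝ) := by gcongr
    _ ≤ h * (L / h) := by gcongr; exact Nat.floor_le (div_nonneg hL0 hh.le)
    _ = L := by field_simp

/-- Exchanging the two finite counts: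
`Σ_{n ∈ S} #{j < J : P n j} = Σ_{j < J} #{n ∈ S : P n j}`. [folklore] -/
theorem sum_card_filter_comm {ι : Type*} (S : Finset ι) (J : ℕ) (P : ι → ℕ → Prop)
    [∀ n j, Decidable (P n j)] :
    ∑ n ∈ S, ((Finset.range J).filter fun j => P n j).card =
      ∑ j ∈ Finset.range J, (S.filter fun n => P n j).card := by
  simp only [Finset.card_filter]
  exact Finset.sum_comm

/-- A sequence of uniform density `d` (`|μ_n - n/d| ≤ M`) has at least `2d(ρ - M) - 1` terms with
`|μ_n| ≤ ρ` among the indices `|n| ≤ N` as soon as `d(ρ + M) ≤ N`… here in the convenient form: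
the count inside any finset containing all `n` with `|n| ≤ d(ρ - M)`. [folklore] -/
theorem two_mul_sub_le_card_filter {μ : ℤ → ℝ} {d M ρ : ℝ} (hd : 0 < d)
    (hμ : ∀ n, |μ n - n / d| ≤ M) (S : Finset ℤ)
    (hS : ∀ n : ℤ, (|(n : ℝ)| ≤ d * (ρ - M)) → n ∈ S) :
    2 * d * (ρ - M) - 1 ≤ ((S.filter fun n => |μ n| ≤ ρ).card : ℝ) := by
  by_cases hρ : ρ < M
  · have : 2 * d * (ρ - M) - 1 < 0 := by nlinarith
    linarith [(Nat.cast_nonneg _ : (0 : ℝ) ≤ ((S.filter fun n => |μ n| ≤ ρ).card : ℝ))]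
  push Not at hρ
  set m : ℕ := ⌊d * (ρ - M)⌋₊ with hm
  have hm0 : (m : ℝ) ≤ d * (ρ - M) := Nat.floor_le (by nlinarith)
  have hsub : Finset.Icc (-(m : ℤ)) m ⊆ S.filter fun n => |μ n| ≤ ρ := by
    intro n hn
    rw [Finset.mem_Icc] at hn
    have habs : |(n : ℝ)| ≤ m := by
      rw [abs_le]
      exact ⟨by exact_mod_cast hn.1, by exact_mod_cast hn.2⟩
    have habs' : |(n : ℝ)| ≤ d * (ρ - M) := habs.trans hm0
    rw [Finset.mem_filter]
    refine ⟨hS n habs', ?_⟩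
    have h1 := hμ n
    have h2 : |(n : ℝ) / d| ≤ ρ - M := by
      rw [abs_div, abs_of_pos hd, div_le_iff₀ hd]
      linarith
    calc |μ n| = |(μ n - n / d) + n / d| := by ring_nf
      _ ≤ |μ n - n / d| + |(n : ℝ) / d| := abs_add_le _ _
      _ ≤ M + (ρ - M) := add_le_add h1 h2
      _ = ρ := by ring
  have hcard := Finset.card_le_card hsub
  rw [Int.card_Icc] at hcard
  have hto : ((m : ℤ) + 1 - -(m : ℤ)).toNat = 2 * m + 1 := by omega
  rw [hto] at hcard
  have h3 : ((2 * m + 1 : ℕ) : ℝ) ≤ ((S.filter fun n => |μ n| ≤ ρ).card : ℝ) := by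
    exact_mod_cast hcard
  have h4 : d * (ρ - M) < m + 1 := by rw [hm]; exact Nat.lt_floor_add_one _
  push_cast at h3
  linarith

/-! ### The level-set parameters and the linear lower bound -/

/-- Choice of the level-set parameters: for `0 ≤ q < 1` there are `h > 0` and `J` with
`q + h ≤ h Σ_{j<J} e^{-(j+1)h}` (the Riemann sum tends to `∫₀^∞ e^{-t} dt = 1 > q`). [folklore] -/
theorem exists_levelSet_parameters {q : ℝ} (hq0 : 0 ≤ q) (hq1 : q < 1) :
    ∃ (h : ℝ) (J : ℕ), 0 < h ∧
      q + h ≤ h * ∑ j ∈ Finset.range J, Real.exp (-h) ^ (j + 1) := by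
  set h : ℝ := (1 - q) / 3 with hh
  have hh0 : 0 < h := by rw [hh]; linarith
  have hh1 : h ≤ 1 / 3 := by rw [hh]; linarith
  set x : ℝ := Real.exp (-h) with hx
  have hx0 : 0 < x := Real.exp_pos _
  have hx1 : x < 1 := by rw [hx]; exact Real.exp_lt_one_iff.2 (by linarith)
  have hx2 : 1 - h ≤ x := by
    have := Real.add_one_le_exp (-h)
    rw [hx]; linarith
  set J : ℕ := ⌈1 / h ^ 2⌉₊ with hJ
  have hJ1 : 1 / h ^ 2 ≤ J := Nat.le_ceil _
  have hxJ : x ^ J ≤ h := by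
    -- `e^{-Jh} ≤ 1/(1 + Jh) ≤ h` as `J h² ≥ 1`
    have h1 : x ^ J = Real.exp (-(J * h)) := by rw [hx, ← Real.exp_nat_mul]; ring_nf
    have h2 : Real.exp (-(J * h)) ≤ 1 / (1 + J * h) := by
      rw [le_div_iff₀ (by positivity), Real.exp_neg]
      have := Real.add_one_le_exp ((J : ℝ) * h)
      have hpos : 0 < Real.exp ((J : ℝ) * h) := Real.exp_pos _
      rw [inv_mul_le_iff₀ hpos]
      linarith
    have h3 : 1 / (1 + (J : ℝ) * h) ≤ h := by
      rw [div_le_iff₀ (by positivity)]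
      have h4 : 1 ≤ (J : ℝ) * h ^ 2 := by
        have := mul_le_mul_of_nonneg_right hJ1 (sq_nonneg h)
        rwa [one_div, inv_mul_cancel₀ (by positivity)] at this
      nlinarith
    rw [h1]; exact h2.trans h3
  set T : ℝ := ∑ j ∈ Finset.range J, x ^ j with hT
  have hT0 : 0 ≤ T := Finset.sum_nonneg fun j _ => pow_nonneg hx0.le j
  have hTgeom : T * (1 - x) = 1 - x ^ J := by
    have := geom_sum_mul x J
    rw [hT]; linarith [this]
  have hsum : ∑ j ∈ Finset.range J, x ^ (j + 1) = x * T := by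
    rw [hT, Finset.mul_sum]
    exact Finset.sum_congr rfl fun j _ => by ring
  refine ⟨h, J, hh0, ?_⟩
  rw [hsum]
  -- `h x ≥ (1-h)(1-x)`, so `h x T ≥ (1-h)(1-x^J) ≥ (1-h)² ≥ 1 - 2h = q + h`
  have h1 : (1 - h) * (1 - x) ≤ h * x := by nlinarith
  have h2 : (1 - h) * (1 - x ^ J) ≤ h * (x * T) := by
    rw [← hTgeom]
    have := mul_le_mul_of_nonneg_right h1 hT0
    nlinarith
  have h3 : (1 - h) * (1 - h) ≤ (1 - h) * (1 - x ^ J) :=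
    mul_le_mul_of_nonneg_left (by linarith) (by linarith)
  have h4 : q + h ≤ (1 - h) * (1 - h) := by rw [hh]; nlinarith
  linarith

/-- The level-set count against a sequence of uniform density: with
`S = {|n| ≤ ⌈d(R+M)⌉ : |μ_n| ≤ R}`,
`2dR · hΣ_{j<J} e^{-(j+1)h} - Jh(2dM+1) ≤ Σ_{n ∈ S} log(R/|μ_n|)`. [folklore] -/
theorem levelSet_count_le_sum_log {μ : ℤ → ℝ} {d M : ℝ} (hd : 0 < d) (hM : 0 ≤ M)
    (hμ : ∀ n, |μ n - n / d| ≤ M) (hμ0 : ∀ n, μ n ≠ 0) {R h : ℝ} (hR : 0 < R) (hh : 0 < h)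
    (J : ℕ) :
    2 * d * R * (h * ∑ j ∈ Finset.range J, Real.exp (-h) ^ (j + 1)) - J * h * (2 * d * M + 1) ≤
      ∑ n ∈ (Finset.Icc (-(⌈d * (R + M)⌉₊ : ℤ)) ⌈d * (R + M)⌉₊).filter (fun n => |μ n| ≤ R),
        Real.log (R / |μ n|) := by
  classical
  set x : ℝ := Real.exp (-h) with hx
  have hx0 : 0 < x := Real.exp_pos _
  have hx1 : x ≤ 1 := by rw [hx]; exact Real.exp_le_one_iff.2 (by linarith)
  set N : ℕ := ⌈d * (R + M)⌉₊ with hN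
  set S : Finset ℤ := (Finset.Icc (-(N : ℤ)) N).filter fun n => |μ n| ≤ R with hS
  have hSR : ∀ n ∈ S, |μ n| ≤ R := fun n hn => (Finset.mem_filter.1 hn).2
  have step1 : ∑ n ∈ S, h * (((Finset.range J).filter fun j => |μ n| ≤ R * x ^ (j + 1)).card : ℝ)
      ≤ ∑ n ∈ S, Real.log (R / |μ n|) :=
    Finset.sum_le_sum fun n hn => mul_card_filter_le_log_div (abs_pos.2 (hμ0 n)) (hSR n hn) hh J
  have step2 : ∑ n ∈ S, h * (((Finset.range J).filter fun j => |μ n| ≤ R * x ^ (j + 1)).card : ℝ)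
      = h * ∑ j ∈ Finset.range J, ((S.filter fun n => |μ n| ≤ R * x ^ (j + 1)).card : ℝ) := by
    rw [← Finset.mul_sum]
    congr 1
    exact_mod_cast sum_card_filter_comm S J (fun n j => |μ n| ≤ R * x ^ (j + 1))
  have step3 : ∀ j ∈ Finset.range J,
      2 * d * (R * x ^ (j + 1) - M) - 1 ≤ ((S.filter fun n => |μ n| ≤ R * x ^ (j + 1)).card : ℝ) := by
    intro j _
    have hxle : x ^ (j + 1) ≤ 1 := pow_le_one₀ hx0.le hx1
    have hρR : R * x ^ (j + 1) ≤ R := mul_le_of_le_one_right hR.le hxle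
    refine two_mul_sub_le_card_filter hd hμ S fun n hn => ?_
    have hn' : |(n : ℝ)| ≤ d * (R + M) :=
      hn.trans (mul_le_mul_of_nonneg_left (by linarith) hd.le)
    have hnN : |(n : ℝ)| ≤ N := hn'.trans (Nat.le_ceil _)
    obtain ⟨hl, hr⟩ := abs_le.1 hnN
    have hl' : -(N : ℤ) ≤ n := by exact_mod_cast hl
    have hr' : n ≤ (N : ℤ) := by exact_mod_cast hr
    refine Finset.mem_filter.2 ⟨Finset.mem_Icc.2 ⟨hl', hr'⟩, ?_⟩
    have h1 := hμ n
    have h2 : |(n : ℝ) / d| ≤ R * x ^ (j + 1) - M := by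
      rw [abs_div, abs_of_pos hd, div_le_iff₀ hd]; linarith
    calc |μ n| = |(μ n - n / d) + n / d| := by ring_nf
      _ ≤ |μ n - n / d| + |(n : ℝ) / d| := abs_add_le _ _
      _ ≤ M + (R * x ^ (j + 1) - M) := add_le_add h1 h2
      _ ≤ R := by linarith
  have step4 : ∑ j ∈ Finset.range J, (2 * d * (R * x ^ (j + 1) - M) - 1) =
      2 * d * R * ∑ j ∈ Finset.range J, x ^ (j + 1) - J * (2 * d * M + 1) := by
    have e1 : (J : ℝ) * (2 * d * M + 1) = ∑ j ∈ Finset.range J, (2 * d * M + 1) := by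
      rw [Finset.sum_const, Finset.card_range, nsmul_eq_mul]
    rw [e1, Finset.mul_sum, ← Finset.sum_sub_distrib]
    exact Finset.sum_congr rfl fun j _ => by ring
  have step5 : h * ∑ j ∈ Finset.range J, (2 * d * (R * x ^ (j + 1) - M) - 1) ≤
      h * ∑ j ∈ Finset.range J, ((S.filter fun n => |μ n| ≤ R * x ^ (j + 1)).card : ℝ) :=
    mul_le_mul_of_nonneg_left (Finset.sum_le_sum step3) hh.le
  rw [step4] at step5
  have e : h * (2 * d * R * ∑ j ∈ Finset.range J, x ^ (j + 1) - J * (2 * d * M + 1)) =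
      2 * d * R * (h * ∑ j ∈ Finset.range J, x ^ (j + 1)) - J * h * (2 * d * M + 1) := by ring
  linarith [step1, step2, step5]

/-! ### The circle average of the majorant `log K + b |Re z - 1/2|` -/

/-- On the circle `|z - 1/2| = R` (`R ≥ 0`) the mean of `log K + b |Re z - 1/2|` is at most
`log K + 2bR/π` (it equals it: `(2π)⁻¹ ∫₀^{2π} |cos| = 2/π`). [folklore] -/
theorem circleAverage_log_add_mul_abs_re_le {K b R : ℝ} (hR : 0 ≤ R) :
    Real.circleAverage (fun z : ℂ => Real.log K + b * |z.re - 1 / 2|) ((1 / 2 : ℝ) : ℂ) R ≤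
      Real.log K + 2 * b * R / π := by
  set β : ℝ → ℝ := fun x => Real.log K + b * |x - 1 / 2| with hβ
  have hβc : Continuous β := by rw [hβ]; fun_prop
  have hcont : Continuous fun θ : ℝ => β (1 / 2 + R * Real.cos θ) := hβc.comp (by fun_prop)
  have h1 : Real.circleAverage (fun z : ℂ => β z.re) ((1 / 2 : ℝ) : ℂ) R =
      π⁻¹ * ∫ θ in (0 : ℝ)..π, β (1 / 2 + R * Real.cos θ) :=
    Literature.Analysis.Complex.circleAverage_re_eq fun a₁ a₂ => hcont.intervalIntegrable _ _
  have h2 : (fun z : ℂ => Real.log K + b * |z.re - 1 / 2|) = fun z : ℂ => β z.re := by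
    funext z; rfl
  rw [h2, h1]
  -- integrate the affine-in-`cos` majorants on `[0, π/2]` and `[π/2, π]`
  have key := Literature.Analysis.Complex.integral_le_sum_affine_cos
    (F := fun θ => β (1 / 2 + R * Real.cos θ)) (fun j => (j : ℝ) * (π / 2)) (fun _ => Real.log K)
    (fun j => if j = 0 then b * R else -(b * R)) 2
    (fun j _ => by
      have : (0 : ℝ) ≤ π / 2 := by positivity
      push_cast; nlinarith)
    (fun j _ => hcont.intervalIntegrable _ _)
    (fun j hj x hx => by
      simp only [mem_Icc] at hx
      have hval : β (1 / 2 + R * Real.cos x) = Real.log K + b * (R * |Real.cos x|) := by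
        simp only [hβ, add_sub_cancel_left, abs_mul, abs_of_nonneg hR]
      rw [hval]
      interval_cases j
      · -- `0 ≤ x ≤ π/2`: `|cos x| = cos x`
        norm_num at hx ⊢
        have hc : 0 ≤ Real.cos x := Real.cos_nonneg_of_mem_Icc ⟨by linarith [Real.pi_pos], hx.2⟩
        rw [abs_of_nonneg hc]; ring_nf; rfl
      · -- `π/2 ≤ x ≤ π`: `|cos x| = -cos x`
        norm_num at hx ⊢
        have hc : Real.cos x ≤ 0 :=
          Real.cos_nonpos_of_pi_div_two_le_of_le hx.1 (by linarith [Real.pi_pos])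
        rw [abs_of_nonpos hc]; ring_nf; rfl)
  obtain ⟨-, hint⟩ := key
  simp only [Finset.sum_range_succ, Finset.sum_range_zero, Nat.cast_zero, zero_mul,
    Nat.cast_one, one_mul, if_true, one_ne_zero, if_false, zero_add,
    show ((1 + 1 : ℕ) : ℝ) = 2 by norm_num, Real.sin_zero, Real.sin_pi_div_two] at hint
  rw [show (2 : ℝ) * (π / 2) = π by ring, Real.sin_pi] at hint
  have hπ : 0 < π := Real.pi_pos
  calc π⁻¹ * ∫ θ in (0 : ℝ)..π, β (1 / 2 + R * Real.cos θ)
      ≤ π⁻¹ * (Real.log K * (π / 2 - 0) + b * R * (1 - 0) +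
          (Real.log K * (π - π / 2) + -(b * R) * (0 - 1))) :=
        mul_le_mul_of_nonneg_left hint (inv_nonneg.2 hπ.le)
    _ = Real.log K + 2 * b * R / π := by field_simp; ring


/-! ### Jensen's formula against the zeros `1/2 + iμ_n` -/

/-- The zeros `1/2 + iμ_n`, `|μ_n| ≤ R`, of an entire `F` with `F(1/2) ≠ 0` contribute at least
`Σ log(R/|μ_n|)` to Jensen's sum `Σ_u mult(u) log(R/|1/2 - u|)` over the disc `|s - 1/2| ≤ R`
(`μ` injective). [folklore] -/
theorem sum_log_div_le_jensen_sum {F : ℂ → ℂ} (hF : AnalyticOnNhd ℂ F univ)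
    (h0 : F ((1 / 2 : ℝ) : ℂ) ≠ 0) {μ : ℤ → ℝ} (hinj : Function.Injective μ)
    (hzero : ∀ n, F (1 / 2 + μ n * I) = 0) {R : ℝ} (hR : 0 < R) (S : Finset ℤ)
    (hS : ∀ n ∈ S, |μ n| ≤ R) :
    ∑ n ∈ S, Real.log (R / |μ n|) ≤
      ∑ᶠ u, (MeromorphicOn.divisor F (closedBall ((1 / 2 : ℝ) : ℂ) |R|) u : ℝ) *
        Real.log (R * ‖((1 / 2 : ℝ) : ℂ) - u‖⁻¹) := by
  classical
  set c : ℂ := ((1 / 2 : ℝ) : ℂ) with hc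
  set CB := closedBall c |R| with hCB
  set D := MeromorphicOn.divisor F CB with hD
  set f : ℂ → ℝ := fun v => (D v : ℝ) * Real.log (R * ‖c - v‖⁻¹) with hf
  set u : ℤ → ℂ := fun n => 1 / 2 + μ n * I with hu
  have hc' : c = 1 / 2 := by rw [hc]; push_cast; ring
  have habsR : |R| = R := abs_of_pos hR
  have hFCB : AnalyticOnNhd ℂ F CB := hF.mono (subset_univ _)
  have hcu : ∀ n, c - u n = -(μ n * I) := by intro n; rw [hc', hu]; ring
  have hnorm : ∀ n, ‖c - u n‖ = |μ n| := by
    intro n; rw [hcu, norm_neg, norm_mul, Complex.norm_I, mul_one, Complex.norm_real,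
      Real.norm_eq_abs]
  have huinj : Function.Injective u := by
    intro m n h
    have h' : (μ m : ℂ) * I = μ n * I := by simpa [hu] using h
    have h'' : (μ m : ℂ) = μ n := by simpa using congrArg (fun z => z * (-I)) h'
    exact hinj (by exact_mod_cast h'')
  -- every `μ n` is nonzero and every `u n`, `n ∈ S`, lies in the disc with multiplicity `≥ 1`
  have hμ0 : ∀ n, μ n ≠ 0 := by
    intro n h
    apply h0
    have h1 := hzero n
    rw [h] at h1
    rw [hc']
    simpa using h1
  have humem : ∀ n ∈ S, u n ∈ CB := by
    intro n hn
    rw [hCB, mem_closedBall, dist_comm, dist_eq_norm, hnorm, habsR]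
    exact hS n hn
  have hDge : ∀ n ∈ S, (1 : ℤ) ≤ D (u n) := by
    intro n hn
    rw [hD, MeromorphicOn.AnalyticOnNhd.divisor_apply hFCB (humem n hn)]
    have hne : analyticOrderAt F (u n) ≠ ⊤ := by
      intro htop
      rw [analyticOrderAt_eq_top] at htop
      have hzero' : F = 0 :=
        AnalyticOnNhd.eq_of_eventuallyEq hF analyticOnNhd_const
          (htop.mono fun z hz => by simpa using hz)
      exact h0 (by simp [hzero'])
    obtain ⟨k, hk⟩ := ENat.ne_top_iff_exists.1 hne
    rw [← hk]
    have hk0 : k ≠ 0 := by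
      rintro rfl
      have h1 : analyticOrderAt F (u n) = 0 := by simpa using hk.symm
      exact ((hF (u n) (mem_univ _)).analyticOrderAt_eq_zero.1 h1) (hzero n)
    simp only [ENat.map_coe, WithTop.untop₀_coe, Nat.one_le_cast]
    omega
  -- write the finsum as a finite sum over the (finite) support of the divisor
  have hfin : (Function.support D).Finite := D.finiteSupport (isCompact_closedBall c |R|)
  have hsuppf : Function.support f ⊆ Function.support D := by
    intro v hv
    rw [Function.mem_support] at hv ⊢
    intro h; apply hv; simp [hf, h]
  rw [finsum_eq_sum_of_support_subset_of_finite f hsuppf hfin]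
  -- all terms are nonnegative
  have hfnn : ∀ v, 0 ≤ f v := by
    intro v
    simp only [hf]
    by_cases hv : v ∈ CB
    · have h1 : (0 : ℝ) ≤ D v := by exact_mod_cast MeromorphicOn.AnalyticOnNhd.divisor_nonneg hFCB v
      refine mul_nonneg h1 ?_
      by_cases hvc : v = c
      · simp [hvc]
      · have hpos : 0 < ‖c - v‖ := norm_pos_iff.2 (sub_ne_zero.2 (Ne.symm hvc))
        refine Real.log_nonneg ?_
        rw [le_mul_inv_iff₀ hpos, one_mul]
        rw [hCB, mem_closedBall, dist_comm, dist_eq_norm, habsR] at hv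
        exact hv
    · have : D v = 0 := Function.locallyFinsuppWithin.apply_eq_zero_of_notMem D hv
      simp [this]
  -- compare with the sum over the image of `S`
  have himg : S.image u ⊆ hfin.toFinset := by
    intro v hv
    rw [Finset.mem_image] at hv
    obtain ⟨n, hn, rfl⟩ := hv
    rw [Set.Finite.mem_toFinset, Function.mem_support]
    have := hDge n hn
    omega
  calc ∑ n ∈ S, Real.log (R / |μ n|)
      ≤ ∑ n ∈ S, f (u n) := by
        refine Finset.sum_le_sum fun n hn => ?_
        simp only [hf, hnorm]
        have hlog : 0 ≤ Real.log (R / |μ n|) :=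
          Real.log_nonneg (by rw [le_div_iff₀ (abs_pos.2 (hμ0 n)), one_mul]; exact hS n hn)
        have h1 : (1 : ℝ) ≤ D (u n) := by exact_mod_cast hDge n hn
        rw [div_eq_mul_inv] at hlog ⊢
        nlinarith
    _ = ∑ v ∈ S.image u, f v := (Finset.sum_image fun m _ n _ h => huinj h).symm
    _ ≤ ∑ v ∈ hfin.toFinset, f v :=
        Finset.sum_le_sum_of_subset_of_nonneg himg fun v _ _ => hfnn v

end Literature.NumberTheory.LFunctions

end
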